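import Summits.Ventures.PercRepro.S1CoreCapSpec

/-!
# PercRepro — THE INSTANCE `ν = 3` OF THE 4-CIRCUIT-CAP SPEC, PROVED (p1, gen 23; the s₄ seat)

`fourCapSpec_three : FourCapSpec capPaper 3 5` — the searches' value `Q*(3) = 5` (fourcap.py / fourcap.c /
fourcap_brute.py, three implementations) is a theorem of the kernel. At nullity `3` a configuration is
(i) a single line (cap `≤ 5`), (ii) two lines (cap `≤ 5`: weights `3 + 3`, `3 + 4`, or two one-fat 3-lines through
their fat point, cap `2 + 2`), or (iii) `3` or `4` SIMPLE 3-point lines (cap `≤ 4`): three lines force every line to be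
a simple 3-line (in the ordering that adds a heavier line first it costs `wsum − 2 ≥ 2` and the next two lines
`≥ 1` each, against the budget `3`: `cost_step`, `wsum_le_three_of_three`); four lines force the fourth to lie in
the union of the other three (`1 + 1 + 1` is already spent: `mem_of_four`); five lines are impossible (each point of
a line lies on `≥ 2` of the other four — every triple of them covers it — while each of the four meets the line in
`≤ 1` point: `6 ≤ 4`, `not_five`). With this instance the conditional bounds of `S1CoreCapSum` / `S1CoreCapAvg`
rest on `Q*(4) = 8` and `Q*(5) = 11` only. Axioms: standard.
-/

namespace PercRepro

namespace S1

namespace FourCap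

variable {β : Type} [DecidableEq β]

/-- One step of the cost bookkeeping along an ordering: adding `L` at the head raises the weight of the union by
`wsum (L ∖ U)` (`≥ |L ∖ U|`) and the rank bound by `min |L ∖ U| (2 − min |L ∩ U| 2)`, where `U` is the union of the
lines so far; and `|L ∖ U| + |L ∩ U| = |L|`. -/
theorem cost_step (w : β → ℕ) (L : Finset β) (l : List (Finset β)) (hw : ∀ v ∈ L, 1 ≤ w v) :
    wsum w (unionL (L :: l)) = wsum w (unionL l) + wsum w (L \ unionL l) ∧
    (L \ unionL l).card ≤ wsum w (L \ unionL l) ∧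
    lineRank (L :: l) = lineRank l + min (L \ unionL l).card (2 - min (L ∩ unionL l).card 2) ∧
    (L \ unionL l).card + (L ∩ unionL l).card = L.card := by
  refine ⟨?_, ?_, rfl, ?_⟩
  · simp only [unionL]
    rw [Finset.union_comm]
    exact (wsum_union_ge w _ _).symm
  · unfold wsum
    rw [Finset.card_eq_sum_ones]
    exact Finset.sum_le_sum (fun v hv => hw v (Finset.mem_sdiff.1 hv).1)
  · rw [Finset.card_sdiff, Finset.inter_comm]
    exact Nat.sub_add_cancel (Finset.card_le_card Finset.inter_subset_left)

/-- Bookkeeping for the first line of an ordering: the union of the empty list is empty. -/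
theorem cost_start (w : β → ℕ) (L : Finset β) :
    wsum w (unionL ([] : List (Finset β))) = 0 ∧ lineRank ([] : List (Finset β)) = 0 ∧
    (L ∩ unionL ([] : List (Finset β))).card = 0 ∧ wsum w (L \ unionL ([] : List (Finset β))) = wsum w L := by
  refine ⟨?_, rfl, ?_, ?_⟩ <;> simp [unionL, wsum]

/-- Counting helper: a proposition that holds in every triple of four is at least two of the four. -/
theorem ind_ge_two (a b c d : Prop) [Decidable a] [Decidable b] [Decidable c] [Decidable d]
    (h1 : a ∨ b ∨ c) (h2 : a ∨ b ∨ d) (h3 : a ∨ c ∨ d) (h4 : b ∨ c ∨ d) :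
    2 ≤ (if a then 1 else 0) + (if b then 1 else 0) + (if c then 1 else 0) + (if d then 1 else 0) := by
  by_cases ha : a <;> by_cases hb : b <;> by_cases hc : c <;> by_cases hd : d <;> simp_all

/-- Counting helper: pairwise incompatible propositions are at most one. -/
theorem ind_le_one (a b c : Prop) [Decidable a] [Decidable b] [Decidable c]
    (hab : a → b → False) (hac : a → c → False) (hbc : b → c → False) :
    (if a then 1 else 0) + (if b then 1 else 0) + (if c then 1 else 0) ≤ 1 := by
  by_cases ha : a <;> by_cases hb : b <;> by_cases hc : c <;> simp_all

section Three

variable {w : β → ℕ} {ls : Finset (Finset β)}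
  (h1 : ∀ L ∈ ls, ∀ v ∈ L, w v = 1 ∨ w v = 2)
  (h2 : ∀ L ∈ ls, 3 ≤ L.card ∧ wsum w L ≤ 5)
  (h3 : ∀ L ∈ ls, ∀ L' ∈ ls, L ≠ L' → (L ∩ L').card ≤ 1)
  (h4 : ∀ l : List (Finset β), l.Nodup → (∀ L ∈ l, L ∈ ls) → wsum w (unionL l) ≤ 3 + lineRank l)

include h1 h2 h3 h4

/-- **Three lines force simple 3-lines** at nullity `3`: with two further lines in the configuration, a line has
weight `≤ 3` (the ordering that adds it first costs `wsum − 2`, then `≥ 1` for each of the other two). -/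
theorem wsum_le_three_of_three {L₁ L₂ L₃ : Finset β} (hL₁ : L₁ ∈ ls) (hL₂ : L₂ ∈ ls) (hL₃ : L₃ ∈ ls)
    (h21 : L₂ ≠ L₁) (h31 : L₃ ≠ L₁) (h32 : L₃ ≠ L₂) : wsum w L₁ ≤ 3 := by
  have hw : ∀ L ∈ ls, ∀ v ∈ L, 1 ≤ w v := fun L hL v hv => by rcases h1 L hL v hv with h | h <;> omega
  have hc := h4 [L₃, L₂, L₁] (by simp [h21, h31, h32]) (by simp [hL₁, hL₂, hL₃])
  obtain ⟨a1, b1, c1, d1⟩ := cost_step w L₁ [] (hw L₁ hL₁)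
  obtain ⟨a2, b2, c2, d2⟩ := cost_step w L₂ [L₁] (hw L₂ hL₂)
  obtain ⟨a3, b3, c3, d3⟩ := cost_step w L₃ [L₂, L₁] (hw L₃ hL₃)
  obtain ⟨e0, e1, e2, e3⟩ := cost_start w L₁
  have i2 : (L₂ ∩ unionL [L₁]).card ≤ 1 := by
    simp only [unionL, Finset.union_empty]
    exact h3 L₂ hL₂ L₁ hL₁ h21
  have i3 : (L₃ ∩ unionL [L₂, L₁]).card ≤ 2 := by
    simp only [unionL, Finset.union_empty]
    rw [Finset.inter_union_distrib_left]
    refine (Finset.card_union_le _ _).trans ?_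
    have := h3 L₃ hL₃ L₂ hL₂ h32
    have := h3 L₃ hL₃ L₁ hL₁ h31
    omega
  have k1 := (h2 L₁ hL₁).1
  have k2 := (h2 L₂ hL₂).1
  have k3 := (h2 L₃ hL₃).1
  omega

/-- Every line of a configuration with `≥ 3` lines at nullity `3` has weight `≤ 3`. -/
theorem wsum_le_three_of_two_lt_card (hbig : 2 < ls.card) (L : Finset β) (hL : L ∈ ls) : wsum w L ≤ 3 := by
  obtain ⟨a, b, c, ha, hb, hc, hab, hac, hbc⟩ := Finset.two_lt_card_iff.1 hbig
  by_cases e1 : L = a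
  · subst e1
    exact wsum_le_three_of_three h1 h2 h3 h4 hL hb hc hab.symm hac.symm hbc.symm
  by_cases e2 : L = b
  · subst e2
    exact wsum_le_three_of_three h1 h2 h3 h4 hL ha hc hab hbc.symm hac.symm
  · exact wsum_le_three_of_three h1 h2 h3 h4 hL ha hb (Ne.symm e1) (Ne.symm e2) hab.symm

/-- **Four lines cover each other** at nullity `3`: a fourth line lies in the union of the other three (the first
three lines of any ordering already cost `3`). -/
theorem mem_of_four {A B C D : Finset β} (hA : A ∈ ls) (hB : B ∈ ls) (hC : C ∈ ls) (hD : D ∈ ls)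
    (hBA : B ≠ A) (hCA : C ≠ A) (hCB : C ≠ B) (hDA : D ≠ A) (hDB : D ≠ B) (hDC : D ≠ C) :
    ∀ v ∈ D, v ∈ C ∨ v ∈ B ∨ v ∈ A := by
  have hw : ∀ L ∈ ls, ∀ v ∈ L, 1 ≤ w v := fun L hL v hv => by rcases h1 L hL v hv with h | h <;> omega
  have hc := h4 [D, C, B, A] (by simp [hBA, hCA, hCB, hDA, hDB, hDC]) (by simp [hA, hB, hC, hD])
  obtain ⟨a1, b1, c1, d1⟩ := cost_step w A [] (hw A hA)
  obtain ⟨a2, b2, c2, d2⟩ := cost_step w B [A] (hw B hB)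
  obtain ⟨a3, b3, c3, d3⟩ := cost_step w C [B, A] (hw C hC)
  obtain ⟨a4, b4, c4, d4⟩ := cost_step w D [C, B, A] (hw D hD)
  obtain ⟨e0, e1, e2, e3⟩ := cost_start w A
  have i2 : (B ∩ unionL [A]).card ≤ 1 := by
    simp only [unionL, Finset.union_empty]
    exact h3 B hB A hA hBA
  have i3 : (C ∩ unionL [B, A]).card ≤ 2 := by
    simp only [unionL, Finset.union_empty]
    rw [Finset.inter_union_distrib_left]
    refine (Finset.card_union_le _ _).trans ?_
    have := h3 C hC B hB hCB
    have := h3 C hC A hA hCA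
    omega
  have kA := (h2 A hA).1
  have kB := (h2 B hB).1
  have kC := (h2 C hC).1
  have kD := (h2 D hD).1
  have hD3 : D.card ≤ 3 := by
    have := wsum_le_three_of_three h1 h2 h3 h4 hD hA hB hDA.symm hDB.symm hBA
    have := card_le_wsum w D (h1 D hD)
    omega
  have hcard : D.card ≤ (D ∩ unionL [C, B, A]).card := by omega
  have hsub : D ⊆ unionL [C, B, A] := by
    have heq : D ∩ unionL [C, B, A] = D :=
      Finset.eq_of_subset_of_card_le Finset.inter_subset_left hcard
    intro v hv
    rw [← heq] at hv
    exact (Finset.mem_inter.1 hv).2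
  intro v hv
  have h := hsub hv
  rw [mem_unionL_iff] at h
  simpa using h

/-- **No five lines** at nullity `3`: each of the three points of a line lies on `≥ 2` of the other four lines
(every triple of them covers it), while each of the four meets the line in `≤ 1` point — `6 ≤ 4`. -/
theorem not_five {L₁ L₂ L₃ L₄ L₅ : Finset β} (hL₁ : L₁ ∈ ls) (hL₂ : L₂ ∈ ls) (hL₃ : L₃ ∈ ls)
    (hL₄ : L₄ ∈ ls) (hL₅ : L₅ ∈ ls) (h21 : L₂ ≠ L₁) (h31 : L₃ ≠ L₁) (h32 : L₃ ≠ L₂) (h41 : L₄ ≠ L₁)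
    (h42 : L₄ ≠ L₂) (h43 : L₄ ≠ L₃) (h51 : L₅ ≠ L₁) (h52 : L₅ ≠ L₂) (h53 : L₅ ≠ L₃) (h54 : L₅ ≠ L₄) :
    False := by
  have hc1 : L₁.card = 3 := by
    have := wsum_le_three_of_three h1 h2 h3 h4 hL₁ hL₂ hL₃ h21 h31 h32
    have := card_le_wsum w L₁ (h1 L₁ hL₁)
    have := (h2 L₁ hL₁).1
    omega
  obtain ⟨x, y, z, hxy, hxz, hyz, hL₁eq⟩ := Finset.card_eq_three.1 hc1
  have hx : x ∈ L₁ := by rw [hL₁eq]; simp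
  have hy : y ∈ L₁ := by rw [hL₁eq]; simp
  have hz : z ∈ L₁ := by rw [hL₁eq]; simp
  -- the four coverings of `L₁` by the triples of the other four lines
  have c234 := mem_of_four h1 h2 h3 h4 hL₄ hL₃ hL₂ hL₁ h43.symm h42.symm h32.symm h41.symm h31.symm h21.symm
  have c235 := mem_of_four h1 h2 h3 h4 hL₅ hL₃ hL₂ hL₁ h53.symm h52.symm h32.symm h51.symm h31.symm h21.symm
  have c245 := mem_of_four h1 h2 h3 h4 hL₅ hL₄ hL₂ hL₁ h54.symm h52.symm h42.symm h51.symm h41.symm h21.symm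
  have c345 := mem_of_four h1 h2 h3 h4 hL₅ hL₄ hL₃ hL₁ h54.symm h53.symm h43.symm h51.symm h41.symm h31.symm
  -- each other line meets `L₁` in at most one point
  have col : ∀ L ∈ ls, L ≠ L₁ → ∀ a ∈ L₁, ∀ b ∈ L₁, a ≠ b → a ∈ L → b ∈ L → False := by
    intro L hL hne a ha b hb hab haL hbL
    exact hab (Finset.card_le_one.1 (h3 L hL L₁ hL₁ hne) a (Finset.mem_inter.2 ⟨haL, ha⟩) b
      (Finset.mem_inter.2 ⟨hbL, hb⟩))
  have rx := ind_ge_two (x ∈ L₂) (x ∈ L₃) (x ∈ L₄) (x ∈ L₅) (c234 x hx) (c235 x hx) (c245 x hx) (c345 x hx)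
  have ry := ind_ge_two (y ∈ L₂) (y ∈ L₃) (y ∈ L₄) (y ∈ L₅) (c234 y hy) (c235 y hy) (c245 y hy) (c345 y hy)
  have rz := ind_ge_two (z ∈ L₂) (z ∈ L₃) (z ∈ L₄) (z ∈ L₅) (c234 z hz) (c235 z hz) (c245 z hz) (c345 z hz)
  have k2 := ind_le_one (x ∈ L₂) (y ∈ L₂) (z ∈ L₂) (col L₂ hL₂ h21 x hx y hy hxy)
    (col L₂ hL₂ h21 x hx z hz hxz) (col L₂ hL₂ h21 y hy z hz hyz)
  have k3 := ind_le_one (x ∈ L₃) (y ∈ L₃) (z ∈ L₃) (col L₃ hL₃ h31 x hx y hy hxy)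
    (col L₃ hL₃ h31 x hx z hz hxz) (col L₃ hL₃ h31 y hy z hz hyz)
  have k4 := ind_le_one (x ∈ L₄) (y ∈ L₄) (z ∈ L₄) (col L₄ hL₄ h41 x hx y hy hxy)
    (col L₄ hL₄ h41 x hx z hz hxz) (col L₄ hL₄ h41 y hy z hz hyz)
  have k5 := ind_le_one (x ∈ L₅) (y ∈ L₅) (z ∈ L₅) (col L₅ hL₅ h51 x hx y hy hxy)
    (col L₅ hL₅ h51 x hx z hz hxz) (col L₅ hL₅ h51 y hy z hz hyz)
  omega

/-- A configuration at nullity `3` has at most four lines. -/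
theorem card_le_four : ls.card ≤ 4 := by
  by_contra hlt
  push Not at hlt
  obtain ⟨a, b, c, ha, hb, hc, hab, hac, hbc⟩ := Finset.two_lt_card_iff.1 (by omega : 2 < ls.card)
  have hb' : b ∈ ls.erase a := Finset.mem_erase.2 ⟨hab.symm, hb⟩
  have hc' : c ∈ (ls.erase a).erase b := Finset.mem_erase.2 ⟨hbc.symm, Finset.mem_erase.2 ⟨hac.symm, hc⟩⟩
  have hcard : 1 < (((ls.erase a).erase b).erase c).card := by
    rw [Finset.card_erase_of_mem hc', Finset.card_erase_of_mem hb', Finset.card_erase_of_mem ha]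
    omega
  obtain ⟨d, hd, e, he, hde⟩ := Finset.one_lt_card.1 hcard
  simp only [Finset.mem_erase] at hd he
  exact not_five h1 h2 h3 h4 ha hb hc hd.2.2.2 he.2.2.2 hab.symm hac.symm hbc.symm hd.2.2.1 hd.2.1 hd.1
    he.2.2.1 he.2.1 he.1 hde.symm

/-- **Two lines** at nullity `3` have caps summing to `≤ 5`. -/
theorem cap_add_cap_le_five {L L' : Finset β} (hL : L ∈ ls) (hL' : L' ∈ ls) (hne : L' ≠ L) :
    capPaper L.card (fat w L) + capPaper L'.card (fat w L') ≤ 5 := by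
  have hc := two_line_cost h4 hL hL' hne
  have hint : (L' ∩ L).card ≤ 1 := h3 L' hL' L hL hne
  have kL := h2 L hL
  have kL' := h2 L' hL'
  have wL := wsum_eq_card_add_fat w L (h1 L hL)
  have wL' := wsum_eq_card_add_fat w L' (h1 L' hL')
  have hsd : (L' \ L).card + (L' ∩ L).card = L'.card := by
    rw [Finset.card_sdiff, Finset.inter_comm]
    exact Nat.sub_add_cancel (Finset.card_le_card Finset.inter_subset_left)
  have hwu : wsum w (L' ∪ L) = wsum w L' + wsum w (L \ L') := (wsum_union_ge w L' L).symm
  have hsplit : wsum w (L \ L') + wsum w (L ∩ L') = wsum w L := by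
    rw [← wsum_union_of_disjoint w (Finset.disjoint_sdiff_inter L L'), Finset.sdiff_union_inter]
  have hcases : (L.card = 3 ∧ fat w L = 0) ∨ (L.card = 4 ∧ fat w L = 0) ∨ (L.card = 5 ∧ fat w L = 0) ∨
      (L.card = 3 ∧ fat w L = 1) ∨ (L.card = 4 ∧ fat w L = 1) ∨ (L.card = 3 ∧ fat w L = 2) := by omega
  have hcases' : (L'.card = 3 ∧ fat w L' = 0) ∨ (L'.card = 4 ∧ fat w L' = 0) ∨ (L'.card = 5 ∧ fat w L' = 0) ∨
      (L'.card = 3 ∧ fat w L' = 1) ∨ (L'.card = 4 ∧ fat w L' = 1) ∨ (L'.card = 3 ∧ fat w L' = 2) := by omega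
  have hcomm : (L ∩ L').card = (L' ∩ L).card := by rw [Finset.inter_comm]
  -- the common point, if any
  rcases (by omega : (L ∩ L').card = 0 ∨ (L ∩ L').card = 1) with h0 | hone
  · have hempty : wsum w (L ∩ L') = 0 := by
      rw [Finset.card_eq_zero.1 h0]; simp [wsum]
    rcases hcases with ⟨hk, hf⟩ | ⟨hk, hf⟩ | ⟨hk, hf⟩ | ⟨hk, hf⟩ | ⟨hk, hf⟩ | ⟨hk, hf⟩ <;>
      rcases hcases' with ⟨hk', hf'⟩ | ⟨hk', hf'⟩ | ⟨hk', hf'⟩ | ⟨hk', hf'⟩ | ⟨hk', hf'⟩ | ⟨hk', hf'⟩ <;>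
      first | omega | (rw [hk, hf, hk', hf']; decide)
  · obtain ⟨p, hp⟩ := Finset.card_eq_one.1 hone
    have hpL : p ∈ L := (Finset.mem_inter.1 (hp ▸ Finset.mem_singleton_self p)).1
    have hpL' : p ∈ L' := (Finset.mem_inter.1 (hp ▸ Finset.mem_singleton_self p)).2
    have hwp : wsum w (L ∩ L') = w p := by rw [hp]; simp [wsum]
    rcases h1 L hL p hpL with hp1 | hp2
    · rcases hcases with ⟨hk, hf⟩ | ⟨hk, hf⟩ | ⟨hk, hf⟩ | ⟨hk, hf⟩ | ⟨hk, hf⟩ | ⟨hk, hf⟩ <;>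
        rcases hcases' with ⟨hk', hf'⟩ | ⟨hk', hf'⟩ | ⟨hk', hf'⟩ | ⟨hk', hf'⟩ | ⟨hk', hf'⟩ | ⟨hk', hf'⟩ <;>
        first | omega | (rw [hk, hf, hk', hf']; decide)
    · have hfL : 1 ≤ fat w L := by
        unfold fat
        exact Finset.card_pos.2 ⟨p, Finset.mem_filter.2 ⟨hpL, hp2⟩⟩
      have hfL' : 1 ≤ fat w L' := by
        unfold fat
        exact Finset.card_pos.2 ⟨p, Finset.mem_filter.2 ⟨hpL', hp2⟩⟩
      rcases hcases with ⟨hk, hf⟩ | ⟨hk, hf⟩ | ⟨hk, hf⟩ | ⟨hk, hf⟩ | ⟨hk, hf⟩ | ⟨hk, hf⟩ <;>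
        rcases hcases' with ⟨hk', hf'⟩ | ⟨hk', hf'⟩ | ⟨hk', hf'⟩ | ⟨hk', hf'⟩ | ⟨hk', hf'⟩ | ⟨hk', hf'⟩ <;>
        first | omega | (rw [hk, hf, hk', hf']; decide)

end Three

/-- A single admissible line has cap `≤ 5`. -/
theorem capPaper_le_five {k f : ℕ} (hk : 3 ≤ k) (hkf : k + f ≤ 5) : capPaper k f ≤ 5 := by
  rcases (by omega : (k = 3 ∧ f = 0) ∨ (k = 4 ∧ f = 0) ∨ (k = 5 ∧ f = 0) ∨ (k = 3 ∧ f = 1) ∨ (k = 4 ∧ f = 1) ∨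
      (k = 3 ∧ f = 2)) with ⟨hk, hf⟩ | ⟨hk, hf⟩ | ⟨hk, hf⟩ | ⟨hk, hf⟩ | ⟨hk, hf⟩ | ⟨hk, hf⟩ <;>
    rw [hk, hf] <;> decide

/-- **THE INSTANCE `ν = 3`, PROVED**: `FourCapSpec capPaper 3 5` — the searches' `Q*(3) = 5` is a theorem. -/
theorem fourCapSpec_three : FourCapSpec capPaper 3 5 := by
  intro β _ w ls h1 h2 h3 h4 _ _
  by_cases hbig : 2 < ls.card
  · -- three or four simple 3-lines: every cap is `1`
    have hcap : ∀ L ∈ ls, capPaper L.card (fat w L) = 1 := by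
      intro L hL
      have hw3 := wsum_le_three_of_two_lt_card h1 h2 h3 h4 hbig L hL
      have hcw := card_le_wsum w L (h1 L hL)
      have hcf := wsum_eq_card_add_fat w L (h1 L hL)
      have hk := (h2 L hL).1
      have hc3 : L.card = 3 := by omega
      have hf0 : fat w L = 0 := by omega
      rw [hc3, hf0]
      decide
    have hcount := card_le_four h1 h2 h3 h4
    calc ∑ L ∈ ls, capPaper L.card (fat w L) = ∑ L ∈ ls, 1 := Finset.sum_congr rfl hcap
      _ = ls.card := by simp
      _ ≤ 5 := by omega
  · push Not at hbig
    rcases (by omega : ls.card = 0 ∨ ls.card = 1 ∨ ls.card = 2) with h0 | hone | htwo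
    · rw [Finset.card_eq_zero.1 h0]
      simp
    · obtain ⟨L, rfl⟩ := Finset.card_eq_one.1 hone
      rw [Finset.sum_singleton]
      have hk := h2 L (Finset.mem_singleton_self L)
      have hcf := wsum_eq_card_add_fat w L (h1 L (Finset.mem_singleton_self L))
      exact capPaper_le_five hk.1 (by omega)
    · obtain ⟨L, L', hne, rfl⟩ := Finset.card_eq_two.1 htwo
      rw [Finset.sum_pair hne]
      exact cap_add_cap_le_five h1 h2 h3 h4 (by simp) (by simp) hne.symm

end FourCap

end S1

end PercRepro
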